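import Summits.AnomalousDissipation.AnomalousDissipation.Theses.DecimationAxis

/-!
# Alternative line `fraction` — crux `DecimationAxis.GalerkinFloor` (stmt-AnomalousDissipation-1582)

Route `AnomalousDissipation/DecimationAxis` (route-AnomalousDissipation-DecimationAxis), item
stmt-AnomalousDissipation-1582, crux rank 2.  Crux-strategist seat
planner-cstrat-stmt-AnomalousDissipation-1582-s1-0, 2026-08-17.  This file does NOT replace the live
skeleton `Lines/birth.lean` (same crux directory); it is an ALTERNATIVE line sharing birth's heart.

## The line: SAME HEART, ν-UNIFORM RESOLVED FRACTION (two stubs)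

The live line `birth` cuts the crux at the dissipation seam:
`GalerkinFloor ⇐ stub_uniformGalerkinAnomaly ∧ stub_fixedViscosityResolution`, where the second stub asks,
at every FIXED viscosity, that loud bounded Galerkin trajectories resolve ALL BUT `δ` of their time-averaged
dissipation below one wavenumber `M(ν, …, δ)`, for EVERY `δ > 0`.  In its `K → ∞` limit that is the mean
energy EQUALITY for Galerkin-limit stationary statistical solutions at fixed `ν` — the open "wall" of the
sibling cruxes stmt-14284 / stmt-14330 (`Cruxes/UniformResolution/STRATEGY-CENSUS.md`: UI of the enstrophy
⟺ no dissipation defect ⟺ energy equality ⟺ vanishing mean flux; FMRT 2001 Ch. IV (1.31) is an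
inequality in 3-D).  But birth's composition `GalerkinFloor_of` consumes the stub ONLY at `δ = ε/3`, and
the crux itself only needs that SOME `ν`-uniform positive amount `η` of dissipation is resolved.

* `stub_uniformGalerkinAnomaly` (HEART, XL, open; VERBATIM the registered heart of `birth` — same name, same
  signature over the same transparent vocabulary, so one proof serves both lines): some designer force,
  budgets `E`, `ε > 0`, `ν_j → 0⁺`, and for every `j`, EVENTUALLY IN THE TRUNCATION `K`, a Galerkin
  trajectory on `freqBall K ∖ {0}` with `limsup`-mean energy `≤ E` and `liminf`-mean TOTAL dissipation `≥ ε`.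
* `stub_uniformResolvedFraction` (NEW; strictly weaker than birth's `stub_fixedViscosityResolution`, see
  `uniformResolvedFraction_of_fixedViscosityResolution` below): for every designer force `(N, g)` and budgets
  `E`, `ε > 0` there is ONE `η > 0` such that for EVERY `ν > 0` some wavenumber `M = M(ν)` resolves at least
  `η` of the time-averaged dissipation of EVERY loud(`ε`) bounded(`E`) Galerkin trajectory at viscosity `ν`,
  at EVERY truncation `K`:  `η ≤ liminf`-mean `ν·4π²·Σ_{|k|≤M}|k|²‖c_k‖²`.
  WHY THIS CUT: the instance of this stub at ONE FIXED `ν` (with `η = η(ν)` allowed to depend on `ν`, the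
  Prop `ResolvedFractionAtFixedViscosity` below) is a SOFT THEOREM — no regularity, no uniform
  integrability: if it failed, there would be levels `K_i` and loud bounded trajectories `c_i` with
  `liminf`-mean resolved dissipation below `M_i → ∞` smaller than `η_i → 0`; a Krylov–Bogoliubov cluster law
  `μ_i` of `c_i` along times realising that `liminf` is carried by the `K`-uniform absorbing ball, has
  `∫ D_{M_i} dμ_i < η_i`, and — by the exact Galerkin energy identity averaged in time — `∫ Re Σ⟨g_k, c_k⟩ dμ_i
  = ∫ D_tot dμ_i ≥ ε`; any weak-* limit `μ` on the (weakly compact, metrisable) ball then satisfies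
  `∫ Re Σ⟨g_k,c_k⟩ dμ ≥ ε` (finitely many modes: weakly continuous) and `∫ D_M dμ = lim_i ∫ D_M dμ_i ≤
  liminf_i ∫ D_{M_i} dμ_i = 0` for EVERY `M` (again finitely many modes), i.e. `c_k = 0` `μ`-a.s. for every
  `k ≠ 0`, whence `∫ Re Σ⟨g_k, c_k⟩ dμ = 0 < ε`: contradiction.  (Stationarity of the limit is not even
  used.)  Hence the ONLY open content of `stub_uniformResolvedFraction` is the UNIFORMITY OF `η` AS `ν → 0`:
  "no asymptotically TOTAL dissipation defect" for Galerkin-limit statistics built from loud approximants —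
  a `ν → 0` statement, not a fixed-`ν` regularity statement.  Birth's stub 2, by contrast, is open at
  every single `ν` (it asks the defect to VANISH).  So on this line the crux `GalerkinFloor` carries NO
  fixed-viscosity regularity debt at all: both stubs are statements about the limit `ν → 0`.
  WHY IT MIGHT FAIL: loud bounded Galerkin families at `ν_i → 0` whose Galerkin-limit stationary statistical
  solutions dissipate viscously only `o(1)` of the injected `ε` (Duchon–Robert-type defect carrying
  `(1 − o(1))·ε` at positive viscosity; energy equality for Leray–Hopf / SSS is open, so this is not
  excluded: DuchonRobert2000, arXiv:0704.0759, FoiasRosaTemam2019 §4).  Sources: FoiasManleyRosaTemam2001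
  Ch. IV (1.31)–(1.33), Ch. V; KanedaEtAl2003 (dissipation carried at `k ≲ k_η(ν)`, resolution-independent);
  hub: `Cruxes/UniformResolution/STRATEGY-CENSUS.md` (the wall and `LowModeLoudness`),
  `Cruxes/ResolvedDissipation/WhyItResists.md`, stmt-14284, stmt-14330.

Composition `GalerkinFloor_of` (sorry-free): keep the heart's `(N, g, E, ν_j)`; get `η` from stub 2 at
`(N, g, E, ε)` BEFORE choosing `j`; crux floor `ε_crux := η/2`; at level `j` take `K₀` from the heart and
`M` from stub 2 at `ν_j`; for `K ≥ K₀` the heart's trajectory is loud(`ε`) bounded(`E`), so stub 2 gives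
`η = 2·(η/2) ≤ liminf`-mean resolved dissipation — the crux's clause, concluded BY NAME.

Also in this file (sorry-free, not stubs): `uniformResolvedFraction_of_fixedViscosityResolution` (birth's
stub 2 ⇒ the new stub: this line is formally no harder than birth), `ResolvedFractionAtFixedViscosity` (the
fixed-`ν` instance, a named Prop: the de-risking target for stub-workers, proof sketched above; NOT used by
the composition) with `resolvedFractionAtFixedViscosity_of_uniform` (uniform ⇒ pointwise), and the
pointwise tightness inequality `coeffResolvedDissipation_le` (`D_M ≤ ν·4π²M²·energy`: any witness of the
crux has `M_j² ≥ ε/(2π²ν_jE)`, the Taylor wavenumber — `M` must grow, cf. support item ResolutionFloor).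

## Vocabulary

§0 repeats VERBATIM the transparent vocabulary of `Lines/birth.lean` §0 (`IsDesignerForce`,
`IsCoeffTrajectory`, `coeffEnergy`, `coeffDissipation`, `coeffResolvedDissipation`) in this file's namespace:
crux workfiles under `Cruxes/` are not built as importable modules on the farm (import probe 2026-08-17:
`remote:stale:unbuilt`), so a private copy is kept (playbook: import-unreachable survivor).  The bodies are
character-identical, hence the registered heart's signature is character-identical too.

## Disproof / negatives honoured

No `Cruxes/GalerkinFloor/Disproof.lean` exists (2026-08-17).  `Cruxes/UniformResolution/Disproof.lean` §D
(load-bearing `0 < ν`, `0 < ε`): kept (`0 < ε` is a hypothesis of stub 2 — without it the zero trajectory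
of the zero force would refute `η > 0`; `0 < ν` kept).  `ledger negatives --problem AnomalousDissipation`
(6 statements): none is a Galerkin-trajectory statement.  Route barriers (Marchioro1986, AlexakisDoering2006,
Cheskidov2023 Thm 1.3): inherited by the heart exactly as in birth; none concerns stub 2.
-/

noncomputable section

-- D-0017: single-problem summit ⇒ the duplicated namespace segment is by design.
set_option linter.dupNamespace false

open Filter Set
open Literature.Analysis.FunctionSpaces.Torus Literature.Analysis.FluidPDE

namespace Summit.AnomalousDissipation.AnomalousDissipation.Cruxes.GalerkinFloor.Fraction

open Summit.AnomalousDissipation.AnomalousDissipation.Theses.DecimationAxis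

/-- Lattice frequencies `ℤ³` (local notation). -/
local notation "ℤ³" => Fin 3 → ℤ
/-- Fourier coefficient values `ℂ³` (local notation). -/
local notation "ℂ³" => EuclideanSpace ℂ (Fin 3)

/-! ## §0 Vocabulary — VERBATIM `Lines/birth.lean` §0 (the sub-clauses of `GalerkinFloor`, transparent `def`s) -/

/-- **Designer force** (the four force clauses of `GalerkinFloor`, verbatim): a real (conjugate-symmetric)
coefficient family `g`, band-limited to `freqBall N`, without mean mode, transversal (`k · g k = 0`). -/
def IsDesignerForce (N : ℕ) (g : ℤ³ → ℂ³) : Prop :=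
  IsConjSymm g ∧ (∀ k, k ∉ freqBall N → g k = 0) ∧ g 0 = 0 ∧
    (∀ k : ℤ³, ∑ i, ((k i : ℤ) : ℂ) * g k i = 0)

/-- **Galerkin trajectory on `S` at viscosity `ν` driven by `g↾S`** (the three solution clauses of
`GalerkinFloor`, verbatim). -/
def IsCoeffTrajectory (S : Finset ℤ³) (ν : ℝ) (g : ℤ³ → ℂ³) (c : ℝ → ↥S → ℂ³) : Prop :=
  (∀ t, c t ∈ galerkinSubspace S) ∧ ContinuousOn c (Set.Ici 0) ∧
    (∀ T : ℝ, ∀ t ∈ Set.Icc (0 : ℝ) T,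
      HasDerivWithinAt c (galerkinRHS S ν (fun k => g k) (c t)) (Set.Icc 0 T) t)

/-- Kinetic energy `Σ_{k∈S} ‖c_k(t)‖²` (verbatim the crux's functional). -/
def coeffEnergy {S : Finset ℤ³} (c : ℝ → ↥S → ℂ³) : ℝ → ℝ :=
  fun t => ∑ k : ↥S, ‖c t k‖ ^ 2

/-- TOTAL dissipation rate `ν·4π²·Σ_{k∈S} |k|²‖c_k(t)‖²`. -/
def coeffDissipation {S : Finset ℤ³} (ν : ℝ) (c : ℝ → ↥S → ℂ³) : ℝ → ℝ :=
  fun t => ν * (4 * Real.pi ^ 2 * ∑ k : ↥S, freqNormSq (k : ℤ³) * ‖c t k‖ ^ 2)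

/-- RESOLVED dissipation rate at wavenumber `M`: `ν·4π²·Σ_{k∈S, |k|≤M} |k|²‖c_k(t)‖²` (verbatim the crux's
functional). -/
def coeffResolvedDissipation {S : Finset ℤ³} (ν : ℝ) (M : ℕ) (c : ℝ → ↥S → ℂ³) : ℝ → ℝ :=
  fun t => ν * (4 * Real.pi ^ 2 * ∑ k : ↥S,
    if freqNormSq (k : ℤ³) ≤ (M : ℝ) ^ 2 then freqNormSq (k : ℤ³) * ‖c t k‖ ^ 2 else 0)

/-! ## §1 Registered stubs (the only `sorry`s of the file) -/

/-- **Stub 1 — TRUNCATION-UNIFORM GALERKIN ANOMALY** (the heart; VERBATIM the registered heart of line `birth`,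
same name and signature; XL, open).  Some designer force `(N, g)`, budgets `E`, `ε > 0` and `ν_j → 0⁺` such
that for every `j`, for all truncations `K ≥ K₀(j)`, SOME trajectory of the exact-coupling Galerkin system on
`(freqBall K).erase 0` at viscosity `ν_j` has `limsup`-mean energy `≤ E` and `liminf`-mean TOTAL dissipation
`≥ ε`.  Necessary for the crux (resolved ≤ total).  Why it might fail / sources: as in `Lines/birth.lean`
(KanedaEtAl2003, Sreenivasan1998, Frisch1995 §5.2, FoiasManleyRosaTemam2001 Ch. V, DoeringFoias2002 §2;
Marchioro-type rigidity at every truncation for planar gravest-mode forcing, in tree). -/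
theorem stub_uniformGalerkinAnomaly :
    ∃ (N : ℕ) (g : ℤ³ → ℂ³), IsDesignerForce N g ∧ ∃ (E ε : ℝ), 0 < ε ∧ ∃ ν : ℕ → ℝ,
      (∀ j, 0 < ν j) ∧ Tendsto ν atTop (nhds 0) ∧
      ∀ j, ∃ K₀ : ℕ, ∀ K, K₀ ≤ K → ∀ S : Finset ℤ³, S = (freqBall K).erase 0 →
        ∃ c : ℝ → ↥S → ℂ³, IsCoeffTrajectory S (ν j) g c ∧
          longTimeAvgSup (coeffEnergy c) ≤ E ∧ ε ≤ longTimeAvgInf (coeffDissipation (ν j) c) := by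
  sorry

/-- **Stub 2 — ν-UNIFORM RESOLVED FRACTION** (NEW; open only through the uniformity of `η` in `ν`).  For every
designer force `(N, g)` and budgets `E`, `ε > 0` there is ONE `η > 0` such that for EVERY viscosity `ν > 0`
some wavenumber `M = M(ν)` satisfies: for EVERY truncation `K` and EVERY Galerkin trajectory on
`(freqBall K).erase 0` at viscosity `ν` with `limsup`-mean energy `≤ E` and `liminf`-mean total dissipation
`≥ ε`, the `liminf`-mean dissipation RESOLVED below `M` is `≥ η`.  Strictly weaker than birth's
`stub_fixedViscosityResolution` (`uniformResolvedFraction_of_fixedViscosityResolution`); its fixed-`ν`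
instance `ResolvedFractionAtFixedViscosity` is a soft theorem (Krylov–Bogoliubov + weak-* compactness on
the absorbing ball + weak continuity of finitely-many-mode functionals; module docstring).  Vacuous where no
loud bounded trajectory exists; `0 < ε` is load-bearing (zero force, zero trajectory).
Why it might fail: an asymptotically total dissipation defect — loud bounded families at `ν_i → 0` whose
Galerkin-limit statistics dissipate viscously only `o(ε)` (energy equality open: DuchonRobert2000,
arXiv:0704.0759, FoiasRosaTemam2019 §4).  Sources: FoiasManleyRosaTemam2001 Ch. IV (1.31)–(1.33);
KanedaEtAl2003; hub stmt-14284 / stmt-14330 and `Cruxes/UniformResolution/STRATEGY-CENSUS.md`. -/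
theorem stub_uniformResolvedFraction :
    ∀ (N : ℕ) (g : ℤ³ → ℂ³), IsDesignerForce N g → ∀ (E ε : ℝ), 0 < ε →
      ∃ η : ℝ, 0 < η ∧ ∀ ν : ℝ, 0 < ν → ∃ M : ℕ, ∀ (K : ℕ) (S : Finset ℤ³), S = (freqBall K).erase 0 →
        ∀ c : ℝ → ↥S → ℂ³, IsCoeffTrajectory S ν g c →
          longTimeAvgSup (coeffEnergy c) ≤ E → ε ≤ longTimeAvgInf (coeffDissipation ν c) →
            η ≤ longTimeAvgInf (coeffResolvedDissipation ν M c) := by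
  sorry

/-! ## §2 By-name handles of the registered stubs (hypotheses of the composition; D-0027 §3.3 shape) -/

/-- Statement of stub 1 (`stub_uniformGalerkinAnomaly`), by name. -/
def Statement.stub_uniformGalerkinAnomaly : Prop :=
  type_of% _root_.Summit.AnomalousDissipation.AnomalousDissipation.Cruxes.GalerkinFloor.Fraction.stub_uniformGalerkinAnomaly

/-- Statement of stub 2 (`stub_uniformResolvedFraction`), by name. -/
def Statement.stub_uniformResolvedFraction : Prop :=
  type_of% _root_.Summit.AnomalousDissipation.AnomalousDissipation.Cruxes.GalerkinFloor.Fraction.stub_uniformResolvedFraction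

/-! ## §3 Composition (kernel-checked; no `sorry` outside the two stubs) -/

/-- **The skeleton closes the crux BY NAME**:
`stub_uniformGalerkinAnomaly → stub_uniformResolvedFraction → DecimationAxis.GalerkinFloor`.
Keep the heart's `(N, g, E, ν)`; the resolved fraction `η` is fixed from `(N, g, E, ε)` before `j`; the
crux's floor is `η/2`; at level `j`, `K₀` from the heart and `M` from stub 2 at `ν_j`. -/
theorem GalerkinFloor_of (hA : Statement.stub_uniformGalerkinAnomaly)
    (hB : Statement.stub_uniformResolvedFraction) : GalerkinFloor := by
  obtain ⟨N, g, hg, E, ε, hε, ν, hν, hlim, hAj⟩ := hA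
  obtain ⟨η, hη, hBν⟩ := hB N g hg E ε hε
  obtain ⟨hs, hsupp, hg0, htr⟩ := hg
  refine ⟨N, g, hs, hsupp, hg0, htr, E, η / 2, by positivity, ν, hν, hlim, fun j => ?_⟩
  obtain ⟨K₀, hK₀⟩ := hAj j
  obtain ⟨M, hM⟩ := hBν (ν j) (hν j)
  refine ⟨M, K₀, fun K hK S hS => ?_⟩
  obtain ⟨c, hc, hE, hD⟩ := hK₀ K hK S hS
  obtain ⟨h1, h2, h3⟩ := hc
  have hres : η ≤ longTimeAvgInf (coeffResolvedDissipation (ν j) M c) :=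
    hM K S hS c ⟨h1, h2, h3⟩ hE hD
  have h2η : 2 * (η / 2) = η := by ring
  refine ⟨c, h1, h2, h3, hE, ?_⟩
  rw [h2η]
  exact hres

/-- The composition applied to the (sorried) stubs: the pipeline closes the crux by name (sorries only
upstream, inside the two registered stubs). -/
theorem GalerkinFloor_via_stubs : GalerkinFloor :=
  GalerkinFloor_of stub_uniformGalerkinAnomaly stub_uniformResolvedFraction

/-! ## §4 Relations (sorry-free): the new stub is weaker than birth's; its fixed-ν instance; tightness -/

/-- Birth's second stub, by statement (VERBATIM the registered signature of `Birth.stub_fixedViscosityResolution`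
over the character-identical vocabulary): full resolution up to any loss `δ > 0` at fixed viscosity. -/
def Statement.birth_stub_fixedViscosityResolution : Prop :=
  ∀ ν : ℝ, 0 < ν → ∀ (N : ℕ) (g : ℤ³ → ℂ³), IsDesignerForce N g → ∀ (E ε δ : ℝ), 0 < δ →
    ∃ M : ℕ, ∀ (K : ℕ) (S : Finset ℤ³), S = (freqBall K).erase 0 →
      ∀ c : ℝ → ↥S → ℂ³, IsCoeffTrajectory S ν g c →
        longTimeAvgSup (coeffEnergy c) ≤ E → ε ≤ longTimeAvgInf (coeffDissipation ν c) →
          ε - δ ≤ longTimeAvgInf (coeffResolvedDissipation ν M c)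

/-- **Birth's stub 2 implies the new stub 2** (`η := ε/2`, `δ := ε/2`): the line `fraction` is formally no
harder than the live line `birth`. -/
theorem uniformResolvedFraction_of_fixedViscosityResolution
    (h : Statement.birth_stub_fixedViscosityResolution) : Statement.stub_uniformResolvedFraction := by
  intro N g hg E ε hε
  refine ⟨ε / 2, by positivity, fun ν hν => ?_⟩
  obtain ⟨M, hM⟩ := h ν hν N g hg E ε (ε / 2) (by positivity)
  refine ⟨M, fun K S hS c hc hE hD => ?_⟩
  have h1 : ε - ε / 2 = ε / 2 := by ring
  have := hM K S hS c hc hE hD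
  rw [h1] at this
  exact this

/-- **The fixed-viscosity instance of stub 2** (`η` may depend on `ν`): a SOFT THEOREM (proof: module
docstring / `Lines/fraction.md` §"fixed ν"; Krylov–Bogoliubov cluster laws, weak-* compactness of
probability measures on the `K`-uniform absorbing ball, weak continuity of the finitely-many-mode
functionals `Re Σ⟨g_k, c_k⟩` and `D_M`, and the time-averaged Galerkin energy identity).  Named here as the
de-risking target for stub-workers of this line (lands `--supports stmt-AnomalousDissipation-1582` as a Tools
lemma); it is NOT used by the composition, and it is exactly stub 2 minus the `ν`-uniformity of `η`. -/
def ResolvedFractionAtFixedViscosity : Prop :=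
  ∀ ν : ℝ, 0 < ν → ∀ (N : ℕ) (g : ℤ³ → ℂ³), IsDesignerForce N g → ∀ (E ε : ℝ), 0 < ε →
    ∃ η : ℝ, 0 < η ∧ ∃ M : ℕ, ∀ (K : ℕ) (S : Finset ℤ³), S = (freqBall K).erase 0 →
      ∀ c : ℝ → ↥S → ℂ³, IsCoeffTrajectory S ν g c →
        longTimeAvgSup (coeffEnergy c) ≤ E → ε ≤ longTimeAvgInf (coeffDissipation ν c) →
          η ≤ longTimeAvgInf (coeffResolvedDissipation ν M c)

/-- Uniform ⇒ pointwise: stub 2 implies its fixed-viscosity instance (the converse — uniformity of `η` as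
`ν → 0` — is the whole open content of stub 2). -/
theorem resolvedFractionAtFixedViscosity_of_uniform (h : Statement.stub_uniformResolvedFraction) :
    ResolvedFractionAtFixedViscosity := by
  intro ν hν N g hg E ε hε
  obtain ⟨η, hη, hην⟩ := h N g hg E ε hε
  obtain ⟨M, hM⟩ := hην ν hν
  exact ⟨η, hη, M, hM⟩

/-- **Pointwise tightness** (`D_M ≤ ν·4π²·M²·energy`): the resolved dissipation at wavenumber `M` is at most
`ν·4π²M²` times the energy.  Consequence for the crux: a witness with `limsup`-mean energy `≤ E` and
`liminf`-mean resolved dissipation `≥ 2ε` forces `2ε ≤ ν_j·4π²·M_j²·E`, i.e. `M_j² ≥ ε/(2π²ν_jE)` (the Taylor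
wavenumber): the resolution wavenumber of `GalerkinFloor` necessarily grows as `ν_j → 0`. -/
theorem coeffResolvedDissipation_le {S : Finset ℤ³} {ν : ℝ} (hν : 0 ≤ ν) (M : ℕ) (c : ℝ → ↥S → ℂ³)
    (t : ℝ) :
    coeffResolvedDissipation ν M c t ≤ ν * (4 * Real.pi ^ 2 * (M : ℝ) ^ 2) * coeffEnergy c t := by
  unfold coeffResolvedDissipation coeffEnergy
  have hsum : (∑ k : ↥S, if freqNormSq (k : ℤ³) ≤ (M : ℝ) ^ 2 then freqNormSq (k : ℤ³) * ‖c t k‖ ^ 2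
      else 0) ≤ ∑ k : ↥S, (M : ℝ) ^ 2 * ‖c t k‖ ^ 2 := by
    refine Finset.sum_le_sum fun k _ => ?_
    split_ifs with hk
    · exact mul_le_mul_of_nonneg_right hk (by positivity)
    · positivity
  calc ν * (4 * Real.pi ^ 2 * ∑ k : ↥S,
        if freqNormSq (k : ℤ³) ≤ (M : ℝ) ^ 2 then freqNormSq (k : ℤ³) * ‖c t k‖ ^ 2 else 0)
      ≤ ν * (4 * Real.pi ^ 2 * ∑ k : ↥S, (M : ℝ) ^ 2 * ‖c t k‖ ^ 2) := by
        gcongr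
    _ = ν * (4 * Real.pi ^ 2 * (M : ℝ) ^ 2) * ∑ k : ↥S, ‖c t k‖ ^ 2 := by
        rw [← Finset.mul_sum]; ring

/-- Resolved dissipation is dominated by total dissipation, pointwise (so the crux implies the heart with
`ε ↦ 2ε`: the heart is NECESSARY). -/
theorem coeffResolvedDissipation_le_coeffDissipation {S : Finset ℤ³} {ν : ℝ} (hν : 0 ≤ ν) (M : ℕ)
    (c : ℝ → ↥S → ℂ³) (t : ℝ) :
    coeffResolvedDissipation ν M c t ≤ coeffDissipation ν c t := by
  unfold coeffResolvedDissipation coeffDissipation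
  gcongr with k _
  split_ifs
  · exact le_rfl
  · exact mul_nonneg (freqNormSq_nonneg _) (by positivity)

/-- Both dissipation functionals are nonnegative (no junk branch in the `liminf`s of their running means). -/
theorem coeffResolvedDissipation_nonneg {S : Finset ℤ³} {ν : ℝ} (hν : 0 ≤ ν) (M : ℕ)
    (c : ℝ → ↥S → ℂ³) (t : ℝ) : 0 ≤ coeffResolvedDissipation ν M c t := by
  unfold coeffResolvedDissipation
  refine mul_nonneg hν (mul_nonneg (by positivity) (Finset.sum_nonneg fun k _ => ?_))
  split_ifs
  · exact mul_nonneg (freqNormSq_nonneg _) (by positivity)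
  · exact le_rfl

end Summit.AnomalousDissipation.AnomalousDissipation.Cruxes.GalerkinFloor.Fraction

end
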